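import Summits.KontsevichZagierPeriods.KontsevichZagierPeriods.Theorems.RootDecompRationalCubeDichotomyNashMultiGenP02

/-! # `RootDecompRationalCubeDichotomyNashMultiGenP03` — part 3/16 of the mechanical ≤385-line split of `NashEtaleMultiGen.lean`
(split by the decomp-kz census seat for landing; mathematics unchanged; part 3 continues part 2). -/

open Set MvPolynomial Filter Topology
open Literature.NumberTheory.Transcendental (IsSemialgebraicFunOn)
open Literature.ModelTheory.ExponentialFields (IsSemialgebraic isSemialgebraic_setOf_eval_pos
  isSemialgebraic_setOf_eval_ne_zero)

namespace Summit.KontsevichZagierPeriods.RootDecompRationalCubeDichotomy.Rung29430.MultiGen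
open Summit.KontsevichZagierPeriods.KontsevichZagierPeriods.Theses.RootDecompRationalCubeDichotomy
  (NashEtaleCover NashEtaleLocal PiRationalisation)
open Summit.KontsevichZagierPeriods.RootDecompRationalCubeDichotomy.Rung29430.NashEtaleLocalGlue
  (local_of_simple nashEtaleCover_of_nashEtaleLocal nashEtaleLocal_zero)
open Summit.KontsevichZagierPeriods.RootDecompRationalCubeDichotomy.Rung29430.NashEtaleLocalOne
  (analyticOnNhd_aeval_snoc)
open Summit.KontsevichZagierPeriods.RootDecompRationalCubeDichotomy.RungEtale.Etale
  (piRationalisation_of_nashEtaleCover)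

noncomputable section

/-- **A non-zero `ℚ`-Nash germ never vanishes at a generic point** — the ingredient that makes
the generic `ℚ`-Nash germs a FIELD `K₀` (§4b).  If `g` is `ℚ`-semialgebraic and analytic on an
open `U`, `x₀ ∈ U` has algebraically independent coordinates and `g x₀ = 0`, then `g` vanishes
identically near `x₀`: the minimal relation `q` has constant term vanishing at `x₀`, hence zero,
so `q = w · q₁` with `q₁` of smaller degree, not a relation; then `g · q₁(x, g) ≡ 0` forces
`g ≡ 0` on the (connected) rational box by the identity principle. [folklore] -/
theorem eventually_eq_zero_of_generic {n : ℕ} {g : (Fin n → ℝ) → ℝ} {U : Set (Fin n → ℝ)}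
    (hU : IsOpen U) (hsa : IsSemialgebraicFunOn ℚ U g) (han : AnalyticOnNhd ℝ g U)
    {x₀ : Fin n → ℝ} (hx₀ : x₀ ∈ U) (hind : AlgebraicIndependent ℚ x₀) (hg0 : g x₀ = 0) :
    ∀ᶠ x in 𝓝 x₀, g x = 0 := by
  classical
  obtain ⟨a, b, hxS, hSU⟩ := exists_ratBox_subset hU hx₀
  have hSo : IsOpen (ratBox a b) := isOpen_ratBox a b
  have hSsa : IsSemialgebraicFunOn ℚ (ratBox a b) g := hsa.mono hSU (isSemialgebraic_ratBox a b)
  have hSan : AnalyticOnNhd ℝ g (ratBox a b) := han.mono hSU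
  have hinj : Function.Injective (MvPolynomial.aeval x₀ : PolyRing n →ₐ[ℚ] ℝ) :=
    algebraicIndependent_iff_injective_aeval.mp hind
  have hrel : ∃ d : ℕ, ∃ q : Polynomial (PolyRing n), q ≠ 0 ∧ q.natDegree = d ∧
      ∀ x ∈ ratBox a b, evP n x (g x) q = 0 := by
    obtain ⟨q, hq0, hq⟩ := exists_relation_poly hSsa
    exact ⟨_, q, hq0, rfl, hq⟩
  obtain ⟨q, hq0, hqm, hq⟩ := Nat.find_spec hrel
  have hmin : ∀ q' : Polynomial (PolyRing n), q' ≠ 0 → (∀ x ∈ ratBox a b, evP n x (g x) q' = 0) →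
      q.natDegree ≤ q'.natDegree := fun q' h0 h => by
    rw [hqm]
    exact Nat.find_min' hrel ⟨q', h0, rfl, h⟩
  -- the constant term of `q` vanishes at the generic point `x₀`, hence is zero
  have hc0 : q.coeff 0 = 0 := by
    have h1 := hq x₀ hxS
    rw [hg0, evP_apply, Polynomial.eval₂_at_zero] at h1
    exact hinj (by rw [map_zero]; exact h1)
  have hqX : q = Polynomial.X * q.divX := by
    have h := Polynomial.X_mul_divX_add q
    rw [hc0, map_zero, add_zero] at h
    exact h.symm
  have hdX0 : q.divX ≠ 0 := fun h => hq0 (by rw [hqX, h, mul_zero])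
  have hdeg : q.natDegree = q.divX.natDegree + 1 := by
    conv_lhs => rw [hqX]
    exact Polynomial.natDegree_X_mul hdX0
  -- by minimality `q.divX` is not a relation on the box
  have hnot : ¬ ∀ x ∈ ratBox a b, evP n x (g x) q.divX = 0 := fun h => by
    have := hmin _ hdX0 h
    omega
  push Not at hnot
  obtain ⟨z, hzS, hz⟩ := hnot
  have hφ : (fun x => evP n x (g x) q.divX) =
      fun x => MvPolynomial.aeval (Fin.snoc x (g x) : Fin (n + 1) → ℝ) (fromPoly n q.divX) :=
    funext fun x => (aeval_snoc_fromPoly x (g x) _).symm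
  have hφan : AnalyticOnNhd ℝ (fun x => evP n x (g x) q.divX) (ratBox a b) := by
    rw [hφ]
    exact analyticOnNhd_aeval_snoc hSan (fromPoly n q.divX)
  have hgφ : ∀ x ∈ ratBox a b, g x * evP n x (g x) q.divX = 0 := fun x hx => by
    have h := hq x hx
    rwa [hqX, map_mul, evP_X] at h
  -- `g ≡ 0` near `z` (where `q.divX(z, g z) ≠ 0`), hence on the whole preconnected box
  have hev : g =ᶠ[𝓝 z] 0 := by
    filter_upwards [(hφan z hzS).continuousAt.eventually_ne hz, hSo.mem_nhds hzS] with y hy1 hy2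
    exact (mul_eq_zero.mp (hgφ y hy2)).resolve_right hy1
  have hgS := hSan.eqOn_zero_of_preconnected_of_eventuallyEq_zero (isPreconnected_ratBox a b) hzS hev
  filter_upwards [hSo.mem_nhds hxS] with y hy using hgS hy

/-! ## §4b  The special strata reduce to ONE algebraic fact in print (typed, glue not yet built)

**Mechanism (special ⟶ generic + rational).**  Let `x₀` have defect `d ≥ 1`.  Choose coordinates
`i• ⊂ Fin n` with `x₀ ∘ i•` a transcendence basis of `ℚ(x₀)`; for each remaining `j` let
`t_j := m_j(x_{i•}, x_j)` be the (cleared) minimal polynomial of `x₀ j` over `ℚ(x₀ ∘ i•)` — by the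
defect-0 separability lemma `evP_derivative_ne_zero` (applied to the sub-tuple) `∂_{x_j} t_j (x₀) ≠ 0`,
so `(s, t) := (x_{i•}, (t_j)_j)` are `ℚ`-POLYNOMIAL local coordinates at `x₀`, with `x₀ ↦ (s₀, 0)`,
`s₀` GENERIC and `0` RATIONAL.  Expanding `g = Σ_β G_β(s) t^β`, every Taylor coefficient `G_β` is a
`ℚ`-Nash germ at the generic point `s₀`, hence lies in the FIELD
`K₀ := {germs at s₀ algebraic over ℚ(s)}` (a field because a non-zero generic Nash germ does not
vanish at `s₀`, §4).  So `g ∈ K₀[[t]]` is an algebraic power series over the field `K₀` at the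
`K₀`-rational point `t = 0`, and the fact below (Nagata (44.1) + Swan Thm 2.5, exactly as used in
Castro-Jiménez–Popescu–Rond 2018, proof of Lemma 2.2) gives a one-generator étale presentation with
coefficients `c₁,…,c_m ∈ K₀`; each `c_i(s)` is itself a simple root of its minimal polynomial at
`s₀` (§4 again), so `(c₁,…,c_m, h)` is a `ℚ`-étale system of generators at `x₀` with
block-triangular Jacobian: `MultiGenData n (m+1) g x₀`.  Convergence of `h` follows from the
analytic implicit function theorem (uniqueness of the formal solution).  This handles `d = 1` and
`d ≥ 2` UNIFORMLY and avoids the dead "adjoin transcendental constants" descent: the "constants"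
are Nash functions on the stratum. -/

/-- The evaluation point `(t₁,…,t_d, h) ∈ K[[t]]^{d+1}` for polynomials in `d + 1` variables. -/
noncomputable def pwPoint {d : ℕ} {K : Type} [Field K] (h : MvPowerSeries (Fin d) K) :
    Fin (d + 1) → MvPowerSeries (Fin d) K :=
  Fin.snoc (fun i : Fin d => (MvPowerSeries.X i : MvPowerSeries (Fin d) K)) h

/-- **Named fact `EtaleAlgebraicPowerSeries d` (THEOREM-IN-PRINT: Nagata, *Local Rings* (1962)
(44.1) — algebraic power series = henselisation — plus Swan, *Néron–Popescu desingularization*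
(1998) Thm 2.5 — one-generator standard-étale form; the pair is used verbatim in
Castro-Jiménez–Popescu–Rond, manuscripta math. (2018), proof of Lemma 2.2, p. 4).**
An algebraic formal power series `G ∈ K[[t₁,…,t_d]]` over a field `K` of characteristic `0` admits a
one-generator étale presentation: `h ∈ K[[t]]`, `F A B ∈ K[t,u]` with `F(t,h) = 0`,
`∂_u F(0, h(0)) ≠ 0`, `B(0, h(0)) ≠ 0`, `G · B(t,h) = A(t,h)`.  (Candidate Literature fact; pure
commutative algebra, no real geometry.) -/
def EtaleAlgebraicPowerSeries (d : ℕ) : Prop :=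
  ∀ (K : Type) [Field K] [CharZero K] (G : MvPowerSeries (Fin d) K),
    IsAlgebraic (MvPolynomial (Fin d) K) G →
    ∃ (h : MvPowerSeries (Fin d) K) (F A B : MvPolynomial (Fin (d + 1)) K),
      MvPolynomial.aeval (pwPoint h) F = 0 ∧
      MvPowerSeries.constantCoeff
          (MvPolynomial.aeval (pwPoint h) (MvPolynomial.pderiv (Fin.last d) F)) ≠ 0 ∧
      MvPowerSeries.constantCoeff (MvPolynomial.aeval (pwPoint h) B) ≠ 0 ∧
      G * MvPolynomial.aeval (pwPoint h) B = MvPolynomial.aeval (pwPoint h) A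

/-- The GLUE CLAIM of §4b (UNDECIDED / engineering, Lean-XL: transversal `ℚ`-polynomial coordinates,
Taylor coefficients in the field `K₀` of generic Nash germs, convergence by the analytic implicit
function theorem, assembling the generators): the algebraic fact implies both special strata. -/
def SpecialStrataViaPowerSeries : Prop :=
  (∀ d : ℕ, EtaleAlgebraicPowerSeries d) →
    ∀ n : ℕ, 1 ≤ n → MultiGenDefectOneAt n ∧ MultiGenSpecialAt n

/-- Bookkeeping: with the glue claim and the fact, LEVEL 2 closes. -/
theorem multiGen_special_of_fact (hglue : SpecialStrataViaPowerSeries)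
    (hfact : ∀ d : ℕ, EtaleAlgebraicPowerSeries d) (n : ℕ) (hn : 1 ≤ n) :
    MultiGenDefectOneAt n ∧ MultiGenSpecialAt n :=
  hglue hfact n hn

/-- Degenerate-witness sanity check of the typing (`d = 0`: a power series in no variables is the
constant `G = C (G 0)`, presented by `h := 0`, `F := u`, `A := C (G 0)`, `B := 1`). -/
theorem etaleAlgebraicPowerSeries_zero : EtaleAlgebraicPowerSeries 0 := by
  intro K _ _ G _
  have hG : (MvPowerSeries.C (MvPowerSeries.constantCoeff G) : MvPowerSeries (Fin 0) K) = G := by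
    refine MvPowerSeries.ext fun m => ?_
    obtain rfl : m = 0 := Subsingleton.elim _ _
    rw [MvPowerSeries.coeff_zero_C]
    rfl
  have hpt : pwPoint (0 : MvPowerSeries (Fin 0) K) (Fin.last 0) = 0 := by
    simp only [pwPoint, Fin.snoc_last]
  refine ⟨0, MvPolynomial.X (Fin.last 0), MvPolynomial.C (MvPowerSeries.constantCoeff G), 1,
    ?_, ?_, ?_, ?_⟩
  · rw [MvPolynomial.aeval_X, hpt]
  · rw [MvPolynomial.pderiv_X_self]; simp
  · simp
  · simp [MvPowerSeries.algebraMap_apply, hG]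

/-! ## §4d  Transversal coordinates at special points (§3.1 of the glue) — PROVED

At ANY point `x₀ ∈ ℝⁿ`: choose coordinates `x ∘ e` (`e : Fin m ↪ Fin n`) forming a transcendence
basis of `ℚ(x₀)`; for every other coordinate `j` there is a polynomial `T_j ∈ ℚ[x_e, x_j]` with
`T_j(x₀) = 0` and `∂T_j/∂x_j (x₀) ≠ 0` (the cleared minimal polynomial of `x₀ j` over `ℚ(x₀ ∘ e)`
— simple at `x₀` because `x₀ ∘ e` is GENERIC: `evP_derivative_ne_zero`).  So `(x_e, T)` is a
`ℚ`-polynomial chart at `x₀`, with triangular Jacobian, sending `x₀` to `(generic, 0)`. -/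

/-- Point version of `irreducible_of_minimal`: a relation of `(s₀, a)` of minimal degree is
irreducible over `ℚ(s)` (no analysis needed: `ℝ` is a domain). -/
theorem irreducible_of_minimal_point {m : ℕ} {K : Type*} [Field K] [Algebra (PolyRing m) K]
    [IsFractionRing (PolyRing m) K] {s₀ : Fin m → ℝ} {a : ℝ}
    {q : Polynomial (PolyRing m)} (hq0 : q ≠ 0) (hpos : 0 < q.natDegree) (hq : evP m s₀ a q = 0)
    (hmin : ∀ q' : Polynomial (PolyRing m), q' ≠ 0 → evP m s₀ a q' = 0 →
      q.natDegree ≤ q'.natDegree) :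
    Irreducible (q.map (algebraMap (PolyRing m) K)) := by
  classical
  have hRK : Function.Injective (algebraMap (PolyRing m) K) := IsFractionRing.injective _ _
  have hQdeg : (q.map (algebraMap (PolyRing m) K)).natDegree = q.natDegree :=
    Polynomial.natDegree_map_eq_of_injective hRK _
  have hQ0 : q.map (algebraMap (PolyRing m) K) ≠ 0 := (Polynomial.map_ne_zero_iff hRK).mpr hq0
  refine irreducible_iff.mpr ⟨fun hu => ?_, fun A B hAB => ?_⟩
  · have := Polynomial.natDegree_eq_zero_of_isUnit hu
    omega
  · have hA0 : A ≠ 0 := by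
      rintro rfl
      exact hQ0 (by rw [hAB, zero_mul])
    have hB0 : B ≠ 0 := by
      rintro rfl
      exact hQ0 (by rw [hAB, mul_zero])
    have hdegAB : A.natDegree + B.natDegree = q.natDegree := by
      rw [← hQdeg, hAB, Polynomial.natDegree_mul hA0 hB0]
    obtain ⟨A', ca, hA'0, hca0, hdegA, hcaA⟩ := exists_integer_multiple (n := m) A hA0
    obtain ⟨B', cb, hB'0, hcb0, hdegB, hcbB⟩ := exists_integer_multiple (n := m) B hB0
    have hprod : A' * B' = Polynomial.C (ca * cb) * q := by
      apply Polynomial.map_injective _ hRK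
      rw [Polynomial.map_mul, hcaA, hcbB, Polynomial.map_mul, Polynomial.map_C, hAB, map_mul,
        Polynomial.C_mul]
      ring
    have hαβ : evP m s₀ a A' * evP m s₀ a B' = 0 := by
      rw [← map_mul, hprod, map_mul, evP_C, hq, mul_zero]
    rcases mul_eq_zero.mp hαβ with hA | hB
    · have hmA : q.natDegree ≤ A.natDegree := by
        rw [← hdegA]
        exact hmin A' hA'0 hA
      have hBdeg : B.natDegree = 0 := by omega
      exact Or.inr (isUnit_of_natDegree_eq_zero hB0 hBdeg)
    · have hmB : q.natDegree ≤ B.natDegree := by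
        rw [← hdegB]
        exact hmin B' hB'0 hB
      have hAdeg : A.natDegree = 0 := by omega
      exact Or.inl (isUnit_of_natDegree_eq_zero hA0 hAdeg)

/-- **Simple transversal relation.**  If `s₀` is generic and `a` is algebraic over `ℚ(s₀)`
(i.e. `(s₀, a)` is not algebraically independent), the minimal relation `q ∈ ℚ[s][w]` of
`(s₀, a)` has `a` as a SIMPLE root of `q(s₀, ·)`. -/
theorem exists_simple_relation {m : ℕ} {s₀ : Fin m → ℝ} (hind : AlgebraicIndependent ℚ s₀) {a : ℝ}
    (hdep : ¬ AlgebraicIndependent ℚ (Fin.snoc s₀ a : Fin (m + 1) → ℝ)) :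
    ∃ q : Polynomial (PolyRing m), q ≠ 0 ∧ evP m s₀ a q = 0 ∧
      evP m s₀ a (Polynomial.derivative q) ≠ 0 := by
  classical
  have hinj : Function.Injective (MvPolynomial.aeval s₀ : PolyRing m →ₐ[ℚ] ℝ) :=
    algebraicIndependent_iff_injective_aeval.mp hind
  have hrel : ∃ d : ℕ, ∃ q : Polynomial (PolyRing m), q ≠ 0 ∧ q.natDegree = d ∧ evP m s₀ a q = 0 := by
    rw [algebraicIndependent_iff] at hdep
    push Not at hdep
    obtain ⟨P, hP, hP0⟩ := hdep
    refine ⟨_, toPoly m P, fun h0 => hP0 ?_, rfl, ?_⟩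
    · rw [← fromPoly_toPoly P, h0, map_zero]
    · rw [← aeval_snoc_fromPoly, fromPoly_toPoly]
      exact hP
  obtain ⟨q, hq0, hqm, hq⟩ := Nat.find_spec hrel
  have hmin : ∀ q' : Polynomial (PolyRing m), q' ≠ 0 → evP m s₀ a q' = 0 →
      q.natDegree ≤ q'.natDegree := fun q' h0 h => by
    rw [hqm]
    exact Nat.find_min' hrel ⟨q', h0, rfl, h⟩
  have hpos : 0 < q.natDegree := by
    by_contra hle
    have hm0 : q.natDegree = 0 := by omega
    have hqC : q = Polynomial.C (q.coeff 0) := Polynomial.eq_C_of_natDegree_eq_zero hm0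
    have h1 : MvPolynomial.aeval s₀ (q.coeff 0) = 0 := by
      have := hq
      rwa [hqC, evP_C] at this
    have h2 : q.coeff 0 = 0 := hinj (by rw [h1, map_zero])
    exact hq0 (by rw [hqC, h2, map_zero])
  have hirr := irreducible_of_minimal_point (K := FracField m) hq0 hpos hq hmin
  exact ⟨q, hq0, hq, evP_derivative_ne_zero hind hirr hq⟩

/-- The same in `ℚ[x₁..x_m, w]`: a polynomial `T` with `T(s₀, a) = 0`, `∂_w T(s₀, a) ≠ 0`. -/
theorem exists_transversal_poly {m : ℕ} {s₀ : Fin m → ℝ} (hind : AlgebraicIndependent ℚ s₀) {a : ℝ}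
    (hdep : ¬ AlgebraicIndependent ℚ (Fin.snoc s₀ a : Fin (m + 1) → ℝ)) :
    ∃ T : MvPolynomial (Fin (m + 1)) ℚ,
      MvPolynomial.aeval (Fin.snoc s₀ a : Fin (m + 1) → ℝ) T = 0 ∧
      MvPolynomial.aeval (Fin.snoc s₀ a : Fin (m + 1) → ℝ) (pderiv (Fin.last m) T) ≠ 0 := by
  obtain ⟨q, -, hq, hder⟩ := exists_simple_relation hind hdep
  refine ⟨fromPoly m q, ?_, ?_⟩
  · rw [aeval_snoc_fromPoly]
    exact hq
  · rw [pderiv_last_fromPoly, aeval_snoc_fromPoly]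
    exact hder

/-- Extending `e : Fin m → Fin n` by one more index `j`. -/
def extendEmb {n m : ℕ} (e : Fin m → Fin n) (j : Fin n) : Fin (m + 1) → Fin n :=
  fun i => Fin.lastCases j (fun i' => e i') i

/-- Auxiliary step `extendEmb_last`. [bookkeeping] -/
@[simp] theorem extendEmb_last {n m : ℕ} (e : Fin m → Fin n) (j : Fin n) :
    extendEmb e j (Fin.last m) = j := by
  simp [extendEmb]

/-- Auxiliary step `extendEmb_castSucc`. [bookkeeping] -/
@[simp] theorem extendEmb_castSucc {n m : ℕ} (e : Fin m → Fin n) (j : Fin n) (i : Fin m) :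
    extendEmb e j (Fin.castSucc i) = e i := by
  simp [extendEmb]

/-- Auxiliary step `comp_extendEmb`. [bookkeeping] -/
theorem comp_extendEmb {n m : ℕ} (e : Fin m → Fin n) (j : Fin n) (x₀ : Fin n → ℝ) :
    x₀ ∘ extendEmb e j = (Fin.snoc (x₀ ∘ e) (x₀ j) : Fin (m + 1) → ℝ) := by
  funext i
  induction i using Fin.lastCases with
  | last => simp
  | cast i => simp

/-- Auxiliary step `extendEmb_injective`. [bookkeeping] -/
theorem extendEmb_injective {n m : ℕ} {e : Fin m → Fin n} (he : Function.Injective e) {j : Fin n}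
    (hj : j ∉ Set.range e) : Function.Injective (extendEmb e j) := by
  intro a b hab
  induction a using Fin.lastCases with
  | last =>
    induction b using Fin.lastCases with
    | last => rfl
    | cast i =>
      rw [extendEmb_last, extendEmb_castSucc] at hab
      exact (hj ⟨i, hab.symm⟩).elim
  | cast i =>
    induction b using Fin.lastCases with
    | last =>
      rw [extendEmb_last, extendEmb_castSucc] at hab
      exact (hj ⟨i, hab⟩).elim
    | cast i' =>
      rw [extendEmb_castSucc, extendEmb_castSucc] at hab
      rw [he hab]

/-- Auxiliary step `extendEmb_ne`. [bookkeeping] -/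
theorem extendEmb_ne {n m : ℕ} (e : Fin m → Fin n) (j : Fin n) {l : Fin n} (hl : l ∉ Set.range e)
    (hlj : l ≠ j) (i : Fin (m + 1)) : extendEmb e j i ≠ l := by
  induction i using Fin.lastCases with
  | last =>
    rw [extendEmb_last]
    exact hlj.symm
  | cast i =>
    rw [extendEmb_castSucc]
    exact fun h => hl ⟨i, h⟩

/-- Renaming along `f` kills `∂/∂x_l` for `l` outside the range of `f`. -/
theorem pderiv_rename_eq_zero {m n : ℕ} (f : Fin m → Fin n) (l : Fin n) (hl : ∀ i, f i ≠ l)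
    (p : MvPolynomial (Fin m) ℚ) : pderiv l (MvPolynomial.rename f p) = 0 := by
  classical
  induction p using MvPolynomial.induction_on with
  | C a => simp
  | add p q hp hq => simp [hp, hq]
  | mul_X p i hp =>
    rw [map_mul, MvPolynomial.rename_X, Derivation.leibniz, hp, pderiv_X_of_ne (hl i), smul_zero,
      smul_zero, add_zero]

/-- **The generic rational chart at a point.**  For every `x₀ ∈ ℝⁿ` there are: an injective
`e : Fin m → Fin n` with `x₀ ∘ e` algebraically independent over `ℚ` (a transcendence basis
among the coordinates), and polynomials `T_j ∈ ℚ[x]` (`T_{e i} = x_{e i}`) such that for every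
other index `j`: `T_j(x₀) = 0`, `∂T_j/∂x_j(x₀) ≠ 0`, and `T_j` involves no variable outside
`range e ∪ {j}` — i.e. `x ↦ (x ∘ e, (T_j x)_j)` is a `ℚ`-polynomial map with triangular,
invertible Jacobian at `x₀`, sending `x₀` to `(x₀ ∘ e, 0)`: GENERIC first block, RATIONAL rest. -/
theorem exists_generic_chart {n : ℕ} (x₀ : Fin n → ℝ) :
    ∃ (m : ℕ) (e : Fin m → Fin n) (T : Fin n → MvPolynomial (Fin n) ℚ),
      Function.Injective e ∧ AlgebraicIndependent ℚ (x₀ ∘ e) ∧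
      (∀ i, T (e i) = X (e i)) ∧
      ∀ j ∉ Set.range e,
        MvPolynomial.aeval x₀ (T j) = 0 ∧ MvPolynomial.aeval x₀ (pderiv j (T j)) ≠ 0 ∧
        ∀ l ∉ Set.range e, l ≠ j → pderiv l (T j) = 0 := by
  classical
  let P : ℕ → Prop := fun m =>
    ∃ e : Fin m → Fin n, Function.Injective e ∧ AlgebraicIndependent ℚ (x₀ ∘ e)
  have hP0 : P 0 := ⟨Fin.elim0, fun i => i.elim0, algebraicIndependent_empty_type⟩
  obtain ⟨m, hmP, hmax'⟩ : ∃ m, P m ∧ ∀ k, m < k → k ≤ n → ¬ P k :=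
    ⟨Nat.findGreatest P n, Nat.findGreatest_spec (Nat.zero_le n) hP0,
      fun k hk hkn => Nat.findGreatest_is_greatest hk hkn⟩
  obtain ⟨e, he, hind⟩ := hmP
  -- maximality: adjoining any further coordinate breaks independence
  have hmax : ∀ j ∉ Set.range e,
      ¬ AlgebraicIndependent ℚ (Fin.snoc (x₀ ∘ e) (x₀ j) : Fin (m + 1) → ℝ) := by
    intro j hj hsnoc
    have hemb := extendEmb_injective he hj
    have hPm1 : P (m + 1) := ⟨extendEmb e j, hemb, by rw [comp_extendEmb]; exact hsnoc⟩
    have hle : m + 1 ≤ n := by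
      have := Fintype.card_le_of_injective _ hemb
      simpa only [Fintype.card_fin] using this
    exact hmax' (m + 1) (Nat.lt_succ_self m) hle hPm1
  -- per-coordinate transversal polynomials
  have hT : ∀ j : Fin n, ∃ Tj : MvPolynomial (Fin n) ℚ, j ∉ Set.range e →
      MvPolynomial.aeval x₀ Tj = 0 ∧ MvPolynomial.aeval x₀ (pderiv j Tj) ≠ 0 ∧
      ∀ l ∉ Set.range e, l ≠ j → pderiv l Tj = 0 := by
    intro j
    by_cases hj : j ∈ Set.range e
    · exact ⟨0, fun h => (h hj).elim⟩
    obtain ⟨T', hT'0, hT'1⟩ := exists_transversal_poly hind (hmax j hj)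
    have hemb := extendEmb_injective he hj
    refine ⟨MvPolynomial.rename (extendEmb e j) T', fun _ => ⟨?_, ?_, fun l hl hlj => ?_⟩⟩
    · rw [MvPolynomial.aeval_rename, comp_extendEmb, hT'0]
    · have key : pderiv j (MvPolynomial.rename (extendEmb e j) T') =
          MvPolynomial.rename (extendEmb e j) (pderiv (Fin.last m) T') := by
        have := MvPolynomial.pderiv_rename hemb (Fin.last m) T'
        rwa [extendEmb_last] at this
      rw [key, MvPolynomial.aeval_rename, comp_extendEmb]
      exact hT'1
    · exact pderiv_rename_eq_zero _ l (extendEmb_ne e j hl hlj) T'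
  choose Tf hTf using hT
  refine ⟨m, e, fun i => if i ∈ Set.range e then X i else Tf i, he, hind, fun i => ?_, fun j hj => ?_⟩
  · simp
  · simp only [hj, if_false]
    exact hTf j hj

end
end Summit.KontsevichZagierPeriods.RootDecompRationalCubeDichotomy.Rung29430.MultiGen
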